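import Literature.MathematicalPhysics.QuantumFieldTheory.Balaban1983to89.B9Ineq349SiteFacesAtLettersRLaws

/-!
# `Balaban1983to89.B9Ineq349SiteFacesAtLettersRLawsJ` — T. Bałaban, *Propagators for lattice gauge theories in a background field*, Commun. Math. Phys.
# **99** (1985) 389–434 [Balaban1985BackgroundPropagators], (3.49) p. 399 ⇐ Thm 3.1 (3.42) p. 397 + Thm 3.2 (3.48) p. 398: THE `J`-TWIN OF ROW 25's KNIT
# READER `B9Ineq349SiteFacesAtLettersRLaws.s349_site_of_t37_display348_of_R_knit` ALONG A SUB-FAMILY `f : J → MemberY …` — rows 15∕16's display `h348`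
# (the one SECTION-TAINTED input) asked ONLY along `f`, the conclusion `B9.Stmt349Printed … (fun j => geo9Y (f j)) …` along `f`
# (IR-N06-SECTION-2 road R1, ★★★ director-ym №524 (3); dag-n06-d `R1-JTWIN-SPEC.md` rule (R), cone row «n06-c∕n06-i 349 schemas + reader»)

[4] = T. Bałaban, *Propagators and renormalization transformations for lattice gauge theories. II*, Commun. Math. Phys. **96** (1984) 223–250 [`Balaban1984PropagatorsII`];
[5] = T. Bałaban, *Averaging operations for lattice gauge theories*, Commun. Math. Phys. **98** (1985) 17–51 [`Balaban1985Averaging`].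

statement-level skeleton of published theorems with citation tags; proofs where landed; nothing here is a claim about the Yang–Mills mass gap

THE PRINT.  [B9] p. 399 [PDF 11] l. 5–9, verbatim: *«These theorems imply all the properties of the operator R, or DRD\*, we will need in the future. For the
operator P = I − R we obtain, using again Lemma 2.1, [|P(x, x′)|, |(DP)_μ(x, x′)|, |(PD\*)_ν(x, x′)|, |(DPD\*)_{μν}(x, x′)|] ≦ O(1)[1, (Lʲη)⁻¹, (Lʲη)⁻¹,
(Lʲη)⁻²](L^{j′}η)^{−d} e^{−(1/2)δ₀d(y,y′)} for x ∈ Δ(y), y ∈ Λ_j, x′ ∈ Δ(y′), y′ ∈ Λ_{j′}. (3.49)»* (the `U`-gradient reading of `P_U = I − R_U` used by the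
certificate's `Stmt349Printed` is the cell's gloss of this display); p. 397 Thm 3.1 (3.42); p. 398 Thm 3.2 (3.48); p. 410 *«Theorem 3.7 implies … (3.42)–(3.47)»*;
p. 413 *«This theorem [3.9] implies Theorem 3.2»*; p. 394 (3.24)–(3.25); p. 396 (3.35); [4] (2.3) p. 224, (2.45) p. 231 (the index sets `Λ_j`, `𝔅`).

WHY THIS FILE (cell context).  Under ★★★ №524 the N06 head consumes rows 15∕16∕17 at the SECTION-CARRYING sub-family and displays them on the complement; road R1
re-types the producer cone so that a row proved ONLY along a sub-family `f : J → MemberY …` (the leaf's `J := SCMemberY`, (α5)) suffices.  Rule (R).1′ (taint-only):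
in the row-25 chain the ONE section-tainted input is rows 15∕16's display `h348` (its provenance is dag-n06-j's Thm 3.2 chain along sections); ROW 18's leaf `t37`,
the knit law `hlawK`, the pins `hparS hGp hlev hβ1 hnbr hblkS hblkYS hGpS hDS` and the letters `𝔏 𝔬 bI` are section-FREE and STAY member-wide.  Hence the
Theorem-3.1 side of the reader (`…RLaws.thm31SiteSchemasR_of_t37_lawS`) is used AS IS (a member-wide `Thm31SiteSchemasR` restricts along `f` inside the proof),
and only the Theorem-3.2 side and the final assembly are re-pressed along `f` — n06-i's `B9Ineq349SiteSchemasR.thm32BlkSchemaR_of_majorants` (§4) and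
`B9Ineq349SiteFromBlocksR.stmt349Printed_site_of_blockSchemas_R` (§2), whose proofs are pointwise in the member (`blk348At_of_hasMajorant x …`,
`exists_threshold_349 … x.toKIdx …`), and `…RLaws.majorants348_of_display348_R_at` ∕ `…_of_R_knit` (dag-n06-c gen 30).

WHAT IS PROVED (sorry-free, 0 def; the `J`-form of `Thm32BlkSchemaR` is written INLINE, no new predicate).
* §1 `thm32BlkSchema_of_majorants_J` — the `J`-form of n06-i's §4: block majorants of a two-sided inverse of `L39 (𝔏 (f j)).parS (𝔏 (f j)).Gp U` along `f` ⟹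
  `Blk348At (f j).toKIdx …` along `f` (constant `max(1, cR39·|κ39|·B₁·e^{2δ₁})`); `majorants348_of_display348_R_at_J` — rows 15∕16's display along `f`, with the
  averaging transporter of `L` explicit (`parA`, member-wide pin `(𝔏 x).parS = parA x`), re-thresholded.
* §2 `stmt349Printed_site_of_blockSchemas_R_J (f) (h31 : Thm31SiteSchemasR 𝔸 G c35 𝔏 R₁ R₂) (h32J)` — row 25 ALONG `f`: n06-i's §2 with the Thm-3.1 input
  member-wide and the Thm-3.2 input along `f`; conclusion `B9.Stmt349Printed (d+1) c35 (fun j => geo9Y (f j)) (fun j => bg9YR 𝔸 G R₁ R₂ (f j))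
  (fun j => fineKernelR R₁ R₂ (p349SiteY 𝔸 G (f j) (𝔏 (f j))))` — the shape of `B9LeafXCodedKnitU.stmt349Printed_reindex f` and of the apex
  `B9LeafXCodedKnitUParHXJ.b9LeafX_carriersYUParHX_ofReindexed`'s binder `s349`.
* §3 ★★★ `s349_site_of_t37_display348_of_R_knit_J` — `…_of_R_knit`'s binders VERBATIM IN ORDER with `{J : Type} (f : J → MemberY …)` inserted after `(θ) (Mstar)`
  and `h348` ↦ its form along `f`; conclusion along `f`.  PROOF: `…RLaws`'s law derivation and `thm31SiteSchemasR_of_t37_lawS` verbatim (member-wide), then §1 + §2.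

CONSUMER (dag-n06-d's «KCXS»ᴶ per the SPEC): the tree call of ✓p811955 with `_J` appended, `(f := f)` after `Mstar`, and `h348` the head's J-form row; at `J := MemberY …`,
`f := id` it is `…_of_R_knit` up to `fun x => …` η-expansion.

HONEST SCOPE.  A typing twin (quantifier bookkeeping over landed derivations); proves nothing new of [B9]; the law, ROW 18's leaf and ROWS 15–16's display remain
HYPOTHESES; under R1 the inner-corner question stays DISPLAYED at the K1 face ∕ NODE O join by (α5) (№524 (3)); count-neutral; N06 NOT discharged; one finite
𝕋^{d+1} programme at fixed ε — nothing continuum, nothing OS, nothing about the mass gap.  Cell `pub-ymgap` (HUMAN RULING D-0062), Track A node N06 [B9], seat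
`pub-ymgap-dag-n06-c` (gen 30), 2026-08-31; a NEW file (APPEND-ONLY companion of `…RLaws` ∕ n06-i's `…SchemasR` ∕ `…FromBlocksR`, untouched).
-/

noncomputable section

namespace Literature.MathematicalPhysics.QuantumFieldTheory.Balaban1983to89.B9Ineq349SiteFacesAtLettersRLawsJ

open B6RandomWalk (HasMajorant)
open B6GlobalChartV1 (blkV1)
open B6Ineq2142KLevelV1 (lvl β)
open B9Thm34Ext (toB6)
open B9Thm37Whole (Ops)
open B9Thm39WholeBlk (Conv348Blk)
open B9Thm39ReadingCoords (cR39)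
open B9Thm39ReadingAtLetters (κ39 basis39 X39 L39)
open B9Thm39OneCubeReadingAtLettersY (oneCubeOps39)
open B9CoReadingCoordsS (XSK blkSK sIK GcoS DcoS)
open B9Ineq349SiteReading (p349SiteY)
open B9Ineq349SiteComposite (Blk348At)
open B9Ineq349SiteFromBlocks (exists_threshold_349 geo9Y_len_eq_lenB geo9Y_dist_eq_distB geo9Y_M_eq p349SiteY_ker)
open B9Ineq349SiteFromBlocksR (Thm31SiteSchemasR)
open B9Ineq349SiteAdjoint (isSymmTr_ringInverse)
open B9Ineq349SiteFromConv348 (blk39F blk348At_of_hasMajorant blk348At_mono)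
open B9Ineq349SiteFacesAtLettersRLaws (thm31SiteSchemasR_of_t37_lawS)
open B9Thm311ReadingCoords (IsSymmTr)
open B9Thm311DeltaPrimeSymm (deltaPrimeAY_isSymmTr_of_inv_symm)
open B9B8AveragingJunction (parKnitY parKnitY_inv)
open B7Prop2Explicit (unitaryUnits)
open B7Prop2SpecialUnitary (specialUnitaryUnits specialUnitaryUnits_le_unitaryUnits)
open B9PinMembersKLevelV1 (MemberY geo9Y bg9Y)
open B9BackgroundsKLevelV1R (RegFamY bg9YR fineKernelR MemOfFam mem_of_reg335R)
open B9RWSumsReadsNbr (nbr)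
open Node00
open scoped Matrix.Norms.L2Operator

/-! ## §1 The Theorem-3.2 side along a sub-family -/

section Blk

variable {𝔸 : Type} [NormedRing 𝔸] [NormedAlgebra ℂ 𝔸] [CompleteSpace 𝔸] [FiniteDimensional ℂ 𝔸] {G : Subgroup 𝔸ˣ}
variable {d ℓ : ℕ} {hd : 1 ≤ d + 1} {hL : Odd (ℓ + 1) ∧ 1 < ℓ + 1} {b₀ b₁ : ℝ} {Mstar : ℕ}
variable (R₁ R₂ : RegFamY d ℓ hd hL b₀ b₁ Mstar 𝔸)

/-- **THE `J`-FORM OF `Thm32BlkSchemaR` FROM BLOCK MAJORANTS ALONG A SUB-FAMILY** (any finite-dimensional `𝔸`, any `G`; class-blind): n06-i's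
`B9Ineq349SiteSchemasR.thm32BlkSchemaR_of_majorants` with the member quantifier read along `f : J → MemberY …` (rule (R).1′∕3: the majorant input is
section-tainted — it comes from rows 15∕16 — so it is asked along `f`; `hlev hβ1` stay member-wide); constant `max(1, cR39·|κ39|·B₁·e^{2δ₁})`.
[cite: Balaban1985BackgroundPropagators, Thm 3.2 (3.48) p.398 ⇐ Thm 3.9 p.413; (3.35) p.396 (the class as a parameter)] -/
theorem thm32BlkSchema_of_majorants_J [∀ x : MemberY d ℓ hd hL b₀ b₁ Mstar, Fintype (geo9Y x).Site] {c35 : ℝ}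
    (𝔏 : ∀ x : MemberY d ℓ hd hL b₀ b₁ Mstar, CovLettersY 𝔸 x) {J : Type} (f : J → MemberY d ℓ hd hL b₀ b₁ Mstar)
    {bI : ∀ x : MemberY d ℓ hd hL b₀ b₁ Mstar, FBondY x.toKIdx → IBondY x.toKIdx}
    (hlev : ∀ (x : MemberY d ℓ hd hL b₀ b₁ Mstar) (f : FBondY x.toKIdx), lvl x.hN x.D x.hk (bI x f) = (blkV1 x.hN x.D f).1.1)
    (hβ1 : ∀ (x : MemberY d ℓ hd hL b₀ b₁ Mstar) (f : FBondY x.toKIdx), (B6Geom246MultiLevelTorus.geomT x.D).dist (β x.hN x.D x.hk (bI x f)) (blkV1 x.hN x.D f) ≤ 1)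
    {R : MemberY d ℓ hd hL b₀ b₁ Mstar → ℝ} {H : MemberY d ℓ hd hL b₀ b₁ Mstar → Prop}
    (h : ∃ M₂ a₀ B₁ δ₁ : ℝ, 0 < M₂ ∧ 0 < a₀ ∧ 0 ≤ B₁ ∧ 0 < δ₁ ∧
      ∀ j : J, M₂ ≤ (geo9Y (f j)).M → ∀ α₀ : ℝ, 0 < α₀ → (geo9Y (f j)).M * α₀ ≤ a₀ →
        ∀ U : (bg9YR 𝔸 G R₁ R₂ (f j)).Cfg, (bg9YR 𝔸 G R₁ R₂ (f j)).Reg335 c35 α₀ U →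
          ∃ T : Module.End ℝ (X39 𝔸 (f j).toKIdx → ℝ),
            T * L39 (f j).toKIdx (𝔏 (f j)).parS (𝔏 (f j)).Gp U = 1 ∧ L39 (f j).toKIdx (𝔏 (f j)).parS (𝔏 (f j)).Gp U * T = 1 ∧
            HasMajorant (g := toB6 (geo9Y (f j)) (R (f j)) (H (f j))) (blk39F 𝔸 (f j).toKIdx (bI (f j))) T
              (fun a a' => B₁ * (geo9Y (f j)).len a ^ (-(4 : ℝ)) * Real.exp (-(δ₁ * (geo9Y (f j)).dist a a')))) :
    ∃ M₁ δ₁ a₀ B₁ : ℝ, 0 < M₁ ∧ 0 < δ₁ ∧ 0 < a₀ ∧ 0 < B₁ ∧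
      ∀ j : J, M₁ ≤ (geo9Y (f j)).M → ∀ α₀ : ℝ, 0 < α₀ → (geo9Y (f j)).M * α₀ ≤ a₀ →
        ∀ U : (bg9YR 𝔸 G R₁ R₂ (f j)).Cfg, (bg9YR 𝔸 G R₁ R₂ (f j)).Reg335 c35 α₀ U →
          Blk348At (f j).toKIdx (𝔏 (f j)).parS (𝔏 (f j)).Gp U B₁ δ₁ := by
  obtain ⟨M₂, a₀, B₁, δ₁, hM₂, ha₀, hB, hδ, hmaj⟩ := h
  refine ⟨M₂, δ₁, a₀, max 1 (cR39 (basis39 𝔸) * Fintype.card (κ39 𝔸) * B₁ * Real.exp (2 * δ₁)), hM₂, hδ, ha₀,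
    lt_of_lt_of_le one_pos (le_max_left _ _), fun j hM α₀ hα₀ hMa U hU => ?_⟩
  obtain ⟨T, hTL, hLT, hm⟩ := hmaj j hM α₀ hα₀ hMa U hU
  exact blk348At_mono (blk348At_of_hasMajorant (f j) (𝔏 (f j)).parS (𝔏 (f j)).Gp U (hlev (f j)) (hβ1 (f j)) hB hδ.le T hTL hLT hm)
    (le_max_right _ _)

end Blk

section Display348

variable {N : ℕ} (θ : Stage3Params) (Mstar : ℕ) (𝔏 : LettersY N θ Mstar)
variable (R₁ R₂ : RegFamY θ.d₆ θ.ℓ₆ θ.hd' θ.hL' θ.b₀ θ.b₁ Mstar (Matrix (Fin N) (Fin N) ℂ))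
variable [∀ x : MemberY θ.d₆ θ.ℓ₆ θ.hd' θ.hL' θ.b₀ θ.b₁ Mstar, Fintype (geo9Y x).Site]
variable (bI : ∀ x : MemberY θ.d₆ θ.ℓ₆ θ.hd' θ.hL' θ.b₀ θ.b₁ Mstar, FBondY x.toKIdx → IBondY x.toKIdx)

/-- **ROWS 15–16's ONE DISPLAY ALONG A SUB-FAMILY, AVERAGING TRANSPORTER OF `L` EXPLICIT, RE-THRESHOLDED** — `…RLaws.majorants348_of_display348_R_at` with the
display read along `f : J → MemberY …` (section-tainted row, rule (R).1′); the pin `(𝔏 x).parS = parA x` stays member-wide.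
[cite: Balaban1985BackgroundPropagators, Thm 3.2 (3.48) p.398 + (3.95)–(3.96) p.411, (3.19) p.393, (3.35) p.396; Balaban1984PropagatorsII, (2.51) p.232] -/
theorem majorants348_of_display348_R_at_J
    (parA : ∀ x : MemberY θ.d₆ θ.ℓ₆ θ.hd' θ.hL' θ.b₀ θ.b₁ Mstar, SiteParY (Matrix (Fin N) (Fin N) ℂ) x.toKIdx)
    (hparS : ∀ x : MemberY θ.d₆ θ.ℓ₆ θ.hd' θ.hL' θ.b₀ θ.b₁ Mstar, (𝔏 x).parS = parA x)
    {J : Type} (f : J → MemberY θ.d₆ θ.ℓ₆ θ.hd' θ.hL' θ.b₀ θ.b₁ Mstar)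
    {c35 : ℝ} (hc : 0 < c35) {B₁ δ₁ a₁ M₁ : ℝ} (hB : 0 ≤ B₁) (hδ : 0 < δ₁) (ha₁ : 0 < a₁) (hM₁ : 0 < M₁)
    (h348 : ∀ j : J, M₁ ≤ (geo9Y (f j)).M → ∀ α₀ : ℝ, 0 < α₀ → c35 * (geo9Y (f j)).M * α₀ ≤ a₁ →
      ∀ U : (bg9YR (Matrix (Fin N) (Fin N) ℂ) (specialUnitaryUnits (Fin N)) R₁ R₂ (f j)).Cfg,
        (bg9YR (Matrix (Fin N) (Fin N) ℂ) (specialUnitaryUnits (Fin N)) R₁ R₂ (f j)).Reg335 c35 α₀ U →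
          Conv348Blk (oneCubeOps39 (geo9Y (f j)) (bg9YR (Matrix (Fin N) (Fin N) ℂ) (specialUnitaryUnits (Fin N)) R₁ R₂ (f j))
            (blk39F (Matrix (Fin N) (Fin N) ℂ) (f j).toKIdx (bI (f j))) (L39 (f j).toKIdx (parA (f j)) (𝔏 (f j)).Gp)) B₁ δ₁ U) :
    ∃ M₂ a₀ B₁ δ₁ : ℝ, 0 < M₂ ∧ 0 < a₀ ∧ 0 ≤ B₁ ∧ 0 < δ₁ ∧
      ∀ j : J, M₂ ≤ (geo9Y (f j)).M → ∀ α₀ : ℝ, 0 < α₀ → (geo9Y (f j)).M * α₀ ≤ a₀ →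
        ∀ U : (bg9YR (Matrix (Fin N) (Fin N) ℂ) (specialUnitaryUnits (Fin N)) R₁ R₂ (f j)).Cfg,
          (bg9YR (Matrix (Fin N) (Fin N) ℂ) (specialUnitaryUnits (Fin N)) R₁ R₂ (f j)).Reg335 c35 α₀ U →
          ∃ T : Module.End ℝ (X39 (Matrix (Fin N) (Fin N) ℂ) (f j).toKIdx → ℝ),
            T * L39 (f j).toKIdx (𝔏 (f j)).parS (𝔏 (f j)).Gp U = 1 ∧ L39 (f j).toKIdx (𝔏 (f j)).parS (𝔏 (f j)).Gp U * T = 1 ∧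
            HasMajorant (g := toB6 (geo9Y (f j)) 0 True) (blk39F (Matrix (Fin N) (Fin N) ℂ) (f j).toKIdx (bI (f j))) T
              (fun a a' => B₁ * (geo9Y (f j)).len a ^ (-(4 : ℝ)) * Real.exp (-(δ₁ * (geo9Y (f j)).dist a a'))) := by
  refine ⟨M₁, a₁ / c35, B₁, δ₁, hM₁, div_pos ha₁ hc, hB, hδ, fun j hM α₀ hα₀ hMa U hU => ?_⟩
  have hMa' : c35 * (geo9Y (f j)).M * α₀ ≤ a₁ := by
    rw [mul_assoc]
    calc c35 * ((geo9Y (f j)).M * α₀) ≤ c35 * (a₁ / c35) := mul_le_mul_of_nonneg_left hMa hc.le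
      _ = a₁ := mul_div_cancel₀ a₁ hc.ne'
  obtain ⟨T, hTL, hLT, hm⟩ := h348 j hM α₀ hα₀ hMa' U hU
  rw [hparS (f j)]
  exact ⟨T, hTL, hLT, hm⟩

end Display348

/-! ## §2 Row 25 along a sub-family from the Thm-3.1 input (member-wide) and the Thm-3.2 input (along `f`) -/

section Record

variable {𝔸 : Type} [NormedRing 𝔸] [NormedAlgebra ℂ 𝔸] [CompleteSpace 𝔸] {G : Subgroup 𝔸ˣ}
variable {d ℓ : ℕ} {hd : 1 ≤ d + 1} {hL : Odd (ℓ + 1) ∧ 1 < ℓ + 1} {b₀ b₁ : ℝ} {Mstar : ℕ}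

/-- ★★ **ROW 25 ALONG A SUB-FAMILY OVER THE CLASS-PARAMETRIC CARRIER**: the printed (3.49) for the genuine `P = I − R(U)` of a letters family, read at the
carrier blocks, at every member `f j` — from the Thm-3.1-type input `Thm31SiteSchemasR` (MEMBER-WIDE: section-free, rule (R).1′) and the Thm-3.2-type input
ALONG `f` (section-tainted); n06-i's `B9Ineq349SiteFromBlocksR.stmt349Printed_site_of_blockSchemas_R` with `x := f j` in its pointwise body (same thresholds,
rate `½·(2θ)`, constant `B₀B₁B₀·C_g`; `exists_threshold_349` is per-`KIdx`).  The conclusion is the `s349` binder shape of the `J`-apex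
`B9LeafXCodedKnitUParHXJ.b9LeafX_carriersYUParHX_ofReindexed` (`B9LeafXCodedKnitU.stmt349Printed_reindex f`).
[cite: Balaban1985BackgroundPropagators, (3.49) p.399; Thm 3.1 (3.42) p.397; Thm 3.2 (3.48) p.398; p.396 (the class as a parameter); Balaban1984PropagatorsII, Lemma 2.1 p.234] -/
theorem stmt349Printed_site_of_blockSchemas_R_J {c35 : ℝ} (𝔏 : ∀ x : MemberY d ℓ hd hL b₀ b₁ Mstar, CovLettersY 𝔸 x)
    (R₁ R₂ : RegFamY d ℓ hd hL b₀ b₁ Mstar 𝔸) {J : Type} (f : J → MemberY d ℓ hd hL b₀ b₁ Mstar)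
    (h31 : Thm31SiteSchemasR 𝔸 G c35 𝔏 R₁ R₂)
    (h32J : ∃ M₁ δ₁ a₀ B₁ : ℝ, 0 < M₁ ∧ 0 < δ₁ ∧ 0 < a₀ ∧ 0 < B₁ ∧
      ∀ j : J, M₁ ≤ (geo9Y (f j)).M → ∀ α₀ : ℝ, 0 < α₀ → (geo9Y (f j)).M * α₀ ≤ a₀ →
        ∀ U : (bg9YR 𝔸 G R₁ R₂ (f j)).Cfg, (bg9YR 𝔸 G R₁ R₂ (f j)).Reg335 c35 α₀ U →
          Blk348At (f j).toKIdx (𝔏 (f j)).parS (𝔏 (f j)).Gp U B₁ δ₁) :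
    B9.Stmt349Printed (d + 1) c35 (fun j => geo9Y (f j)) (fun j => bg9YR 𝔸 G R₁ R₂ (f j))
      (fun j => fineKernelR R₁ R₂ (p349SiteY 𝔸 G (f j) (𝔏 (f j)))) := by
  obtain ⟨M₁, δ₀, a₀, B₀, hM₁, hδ₀, ha₀, hB₀, H31⟩ := h31
  obtain ⟨M₁', δ₁, a₀', B₁, hM₁', hδ₁, ha₀', hB₁, H32⟩ := h32J
  obtain ⟨M₃, θ, Cg, hM₃, hθ, hCg, -, H⟩ := exists_threshold_349 (d := d) (ℓ := ℓ) (hd := hd) (hL := hL) (b₀ := b₀) (b₁ := b₁) hδ₀ hδ₁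
  refine ⟨max M₁ (max M₁' M₃), 2 * θ, min a₀ a₀', B₀ * B₁ * B₀ * Cg, lt_max_of_lt_left hM₁, by positivity, lt_min ha₀ ha₀', by positivity, ?_⟩
  intro j hMx α₀ hα₀ hMa U hU n b b'
  have hM1 : M₁ ≤ (geo9Y (f j)).M := (le_max_left _ _).trans hMx
  have hM1' : M₁' ≤ (geo9Y (f j)).M := ((le_max_left _ _).trans (le_max_right _ _)).trans hMx
  have hM3 : M₃ ≤ ((ℓ : ℝ) + 1) * (f j).Mh := by
    rw [← geo9Y_M_eq]; exact ((le_max_right _ _).trans (le_max_right _ _)).trans hMx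
  obtain ⟨hLe, hRi⟩ := H31 (f j) hM1 α₀ hα₀ (hMa.trans (min_le_left _ _)) U hU
  have h348 := H32 j hM1' α₀ hα₀ (hMa.trans (min_le_right _ _)) U hU
  have key := H (f j).toKIdx hM3 (𝔏 (f j)).parS (𝔏 (f j)).Gp U hB₀.le hB₁.le hLe hRi h348 n (β (f j).hN (f j).D (f j).hk b)
    (β (f j).hN (f j).D (f j).hk b')
  show (p349SiteY 𝔸 G (f j) (𝔏 (f j))).ker n U b b' ≤ _
  rw [p349SiteY_ker, geo9Y_len_eq_lenB, geo9Y_len_eq_lenB, geo9Y_dist_eq_distB,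
    show 2 * θ / 2 = θ by ring]
  exact key

end Record

/-! ## §3 ★★★ The `J`-twin of the knit reader -/

section Knit

variable {N : ℕ} {κ : Type} [Fintype κ] [DecidableEq κ]

/-- ★★★ **ROW 25 OF THE N06 CERTIFICATE AT THE KNIT LETTERS ALONG A SUB-FAMILY `f : J → MemberY …` IN ONE CALL** — the `J`-twin (R1 rule (R)) of
`B9Ineq349SiteFacesAtLettersRLaws.s349_site_of_t37_display348_of_R_knit`: binders VERBATIM in order with `{J} (f)` inserted after `(θ) (Mstar)` and the ONE
section-tainted row — rows 15∕16's display `h348` at `L = Q′(parKnitY)G′²Q′*(parKnitY)` — asked ONLY along `f`; ROW 18's leaf `t37` (any `E` with `hconv`), the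
knit law `hlawK` (legs unitary on the regime below `aK`), the pins and the letters stay member-wide (section-free); conclusion
`B9.Stmt349Printed (d+1) c35 (fun j => geo9Y (f j)) (fun j => bg9YR … R₁ R₂ (f j)) (fun j => fineKernelR R₁ R₂ (p349SiteY … (f j) (𝔏 (f j))))` (= the apex's `s349`
binder at the knit object by `rfl`, `Node00.OpsYRecordV11SH.opsYS349NuOfLettersH_P349`).  The trace-symmetry of `G′(U; parKnitY)` is derived as in the parent
(`isSymmTr_ringInverse ∘ deltaPrimeAY_isSymmTr_of_inv_symm` at `parKnitY_inv`).
[cite: Balaban1985BackgroundPropagators, (3.49) p.399 («using again Lemma 2.1»); Thm 3.1 ⇐ Thm 3.7 p.410; Thm 3.2 ⇐ Thm 3.9 p.413 + (3.95)–(3.96) p.411; (3.19) p.393, (3.24)–(3.25) p.394, (3.35) p.396; Balaban1985Averaging, Prop. 2 p.26, (52)–(53) p.26; Balaban1984PropagatorsII, Lemma 2.1 p.234, (2.51) p.232, (2.3) p.224] -/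
theorem s349_site_of_t37_display348_of_R_knit_J (θ : Stage3Params) (Mstar : ℕ)
    {J : Type} (f : J → MemberY θ.d₆ θ.ℓ₆ θ.hd' θ.hL' θ.b₀ θ.b₁ Mstar)
    (R₁ R₂ : RegFamY θ.d₆ θ.ℓ₆ θ.hd' θ.hL' θ.b₀ θ.b₁ Mstar (Matrix (Fin N) (Fin N) ℂ)) (hGR : MemOfFam (specialUnitaryUnits (Fin N)) R₁)
    (𝔏 : LettersY N θ Mstar)
    (hparS : ∀ x : MemberY θ.d₆ θ.ℓ₆ θ.hd' θ.hL' θ.b₀ θ.b₁ Mstar, (𝔏 x).parS = parKnitY x.toKIdx)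
    (hGp : ∀ x : MemberY θ.d₆ θ.ℓ₆ θ.hd' θ.hL' θ.b₀ θ.b₁ Mstar, (𝔏 x).Gp = GpY x.toKIdx (parKnitY x.toKIdx))
    [∀ x : MemberY θ.d₆ θ.ℓ₆ θ.hd' θ.hL' θ.b₀ θ.b₁ Mstar, Fintype (geo9Y x).Site] [∀ x : MemberY θ.d₆ θ.ℓ₆ θ.hd' θ.hL' θ.b₀ θ.b₁ Mstar, DecidableEq (geo9Y x).Site]
    (b : Module.Basis κ ℝ (Matrix (Fin N) (Fin N) ℂ)) {c35 : ℝ}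
    {bI : ∀ x : MemberY θ.d₆ θ.ℓ₆ θ.hd' θ.hL' θ.b₀ θ.b₁ Mstar, FBondY x.toKIdx → IBondY x.toKIdx}
    (hlev : ∀ (x : MemberY θ.d₆ θ.ℓ₆ θ.hd' θ.hL' θ.b₀ θ.b₁ Mstar) (f : FBondY x.toKIdx), lvl x.hN x.D x.hk (bI x f) = (blkV1 x.hN x.D f).1.1)
    (hβ1 : ∀ (x : MemberY θ.d₆ θ.ℓ₆ θ.hd' θ.hL' θ.b₀ θ.b₁ Mstar) (f : FBondY x.toKIdx),
      (B6Geom246MultiLevelTorus.geomT x.D).dist (β x.hN x.D x.hk (bI x f)) (blkV1 x.hN x.D f) ≤ 1)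
    {mN : ℕ} (hnbr : ∀ (x : MemberY θ.d₆ θ.ℓ₆ θ.hd' θ.hL' θ.b₀ θ.b₁ Mstar) (y : (geo9Y x).Site), (nbr (geo9Y x) 2 y).card ≤ mN)
    -- row 18: Theorem 3.7's leaf over the carrier on ANY expansion family `E` with `hconv` (member-wide, section-free)
    {ι : MemberY θ.d₆ θ.ℓ₆ θ.hd' θ.hL' θ.b₀ θ.b₁ Mstar → Type}
    (𝔬 : ∀ x : MemberY θ.d₆ θ.ℓ₆ θ.hd' θ.hL' θ.b₀ θ.b₁ Mstar, Ops (geo9Y x) (bg9YR (Matrix (Fin N) (Fin N) ℂ) (specialUnitaryUnits (Fin N)) R₁ R₂ x)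
      (XSK κ x.toKIdx) (XSK κ x.toKIdx) (ι x))
    {E : ∀ x : MemberY θ.d₆ θ.ℓ₆ θ.hd' θ.hL' θ.b₀ θ.b₁ Mstar, B9.RWExpansion (geo9Y x) (bg9YR (Matrix (Fin N) (Fin N) ℂ) (specialUnitaryUnits (Fin N)) R₁ R₂ x)}
    (t37 : B9.Thm37Printed c35 (fun x : MemberY θ.d₆ θ.ℓ₆ θ.hd' θ.hL' θ.b₀ θ.b₁ Mstar => geo9Y x)
      (fun x => bg9YR (Matrix (Fin N) (Fin N) ℂ) (specialUnitaryUnits (Fin N)) R₁ R₂ x) E)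
    {R : MemberY θ.d₆ θ.ℓ₆ θ.hd' θ.hL' θ.b₀ θ.b₁ Mstar → ℝ} {H : MemberY θ.d₆ θ.ℓ₆ θ.hd' θ.hL' θ.b₀ θ.b₁ Mstar → Prop} {C δ : ℝ} (hC : 0 ≤ C) (hδ0 : 0 < δ)
    (hconv : ∀ (x : MemberY θ.d₆ θ.ℓ₆ θ.hd' θ.hL' θ.b₀ θ.b₁ Mstar) (U : (bg9YR (Matrix (Fin N) (Fin N) ℂ) (specialUnitaryUnits (Fin N)) R₁ R₂ x).Cfg),
      (E x).Converges U → B9Thm37Whole.Conv342 (𝔬 x) (R x) (H x) C δ U)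
    (hblkS : ∀ x : MemberY θ.d₆ θ.ℓ₆ θ.hd' θ.hL' θ.b₀ θ.b₁ Mstar, (𝔬 x).blk = blkSK x.toKIdx (sIK x.toKIdx (bI x)))
    (hblkYS : ∀ x : MemberY θ.d₆ θ.ℓ₆ θ.hd' θ.hL' θ.b₀ θ.b₁ Mstar, (𝔬 x).blkY = blkSK x.toKIdx (sIK x.toKIdx (bI x)))
    (hGpS : ∀ (x : MemberY θ.d₆ θ.ℓ₆ θ.hd' θ.hL' θ.b₀ θ.b₁ Mstar) (U : (bg9YR (Matrix (Fin N) (Fin N) ℂ) (specialUnitaryUnits (Fin N)) R₁ R₂ x).Cfg),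
      (𝔬 x).Gp U = GcoS x.toKIdx b (bg9YR (Matrix (Fin N) (Fin N) ℂ) (specialUnitaryUnits (Fin N)) R₁ R₂ x) (fun U => U) (𝔏 x).Gp U)
    (hDS : ∀ (x : MemberY θ.d₆ θ.ℓ₆ θ.hd' θ.hL' θ.b₀ θ.b₁ Mstar) (U : (bg9YR (Matrix (Fin N) (Fin N) ℂ) (specialUnitaryUnits (Fin N)) R₁ R₂ x).Cfg),
      (𝔬 x).D U = DcoS x.toKIdx b (bg9YR (Matrix (Fin N) (Fin N) ℂ) (specialUnitaryUnits (Fin N)) R₁ R₂ x) (fun U => U) U)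
    -- the knit law on the regime below the plaquette threshold `aK` (member-wide, section-free)
    {aK : ℝ} (haK : 0 < aK)
    (hlawK : ∀ (x : MemberY θ.d₆ θ.ℓ₆ θ.hd' θ.hL' θ.b₀ θ.b₁ Mstar) (α₀ : ℝ), 0 < α₀ → (geo9Y x).M * α₀ ≤ aK →
      ∀ U : (bg9YR (Matrix (Fin N) (Fin N) ℂ) (specialUnitaryUnits (Fin N)) R₁ R₂ x).Cfg,
        (bg9YR (Matrix (Fin N) (Fin N) ℂ) (specialUnitaryUnits (Fin N)) R₁ R₂ x).Reg335 c35 α₀ U →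
          ∀ z w : SiteY x.toKIdx, parKnitY x.toKIdx U z w ∈ unitaryUnits (Matrix (Fin N) (Fin N) ℂ))
    -- rows 15–16 (SECTION-TAINTED): the display at `L = Q′(parKnitY)G′²Q′*(parKnitY)` asked ONLY ALONG `f`
    (hc : 0 < c35) {B₁ δ₁ a₁ M₁ : ℝ} (hB : 0 ≤ B₁) (hδ : 0 < δ₁) (ha₁ : 0 < a₁) (hM₁ : 0 < M₁)
    (h348 : ∀ j : J, M₁ ≤ (geo9Y (f j)).M → ∀ α₀ : ℝ, 0 < α₀ → c35 * (geo9Y (f j)).M * α₀ ≤ a₁ →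
      ∀ U : (bg9YR (Matrix (Fin N) (Fin N) ℂ) (specialUnitaryUnits (Fin N)) R₁ R₂ (f j)).Cfg,
        (bg9YR (Matrix (Fin N) (Fin N) ℂ) (specialUnitaryUnits (Fin N)) R₁ R₂ (f j)).Reg335 c35 α₀ U →
          Conv348Blk (oneCubeOps39 (geo9Y (f j)) (bg9YR (Matrix (Fin N) (Fin N) ℂ) (specialUnitaryUnits (Fin N)) R₁ R₂ (f j))
            (blk39F (Matrix (Fin N) (Fin N) ℂ) (f j).toKIdx (bI (f j))) (L39 (f j).toKIdx (parKnitY (f j).toKIdx) (𝔏 (f j)).Gp)) B₁ δ₁ U) :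
    B9.Stmt349Printed (θ.d₆ + 1) c35 (fun j => geo9Y (f j))
      (fun j => bg9YR (Matrix (Fin N) (Fin N) ℂ) (specialUnitaryUnits (Fin N)) R₁ R₂ (f j))
      (fun j => fineKernelR R₁ R₂ (p349SiteY (Matrix (Fin N) (Fin N) ℂ) (specialUnitaryUnits (Fin N)) (f j) (𝔏 (f j)))) := by
  -- the displayed law of the parent at the knit pins (member-wide): unitarity is `hlawK`; the symmetry of `G′(U; parKnitY)` is derived
  have hlawS : ∀ (x : MemberY θ.d₆ θ.ℓ₆ θ.hd' θ.hL' θ.b₀ θ.b₁ Mstar) (α₀ : ℝ), 0 < α₀ → (geo9Y x).M * α₀ ≤ aK →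
      ∀ U : (bg9YR (Matrix (Fin N) (Fin N) ℂ) (specialUnitaryUnits (Fin N)) R₁ R₂ x).Cfg,
        (bg9YR (Matrix (Fin N) (Fin N) ℂ) (specialUnitaryUnits (Fin N)) R₁ R₂ x).Reg335 c35 α₀ U →
          (∀ z w : SiteY x.toKIdx, (𝔏 x).parS U z w ∈ unitaryUnits (Matrix (Fin N) (Fin N) ℂ)) ∧ IsSymmTr (fun _ => (1 : ℝ)) ((𝔏 x).Gp U) := by
    intro x α₀ hα₀ hMa U hU
    have hpar := hlawK x α₀ hα₀ hMa U hU
    have hUu : ∀ μ y, U μ y ∈ unitaryUnits (Matrix (Fin N) (Fin N) ℂ) :=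
      fun μ y => specialUnitaryUnits_le_unitaryUnits (mem_of_reg335R hGR x hU μ y)
    refine ⟨fun z w => by rw [hparS x]; exact hpar z w, ?_⟩
    rw [hGp x]
    exact isSymmTr_ringInverse _
      (deltaPrimeAY_isSymmTr_of_inv_symm x.toKIdx le_rfl (parKnitY x.toKIdx) U (parKnitY_inv x.toKIdx U) hpar hUu)
  exact stmt349Printed_site_of_blockSchemas_R_J 𝔏 R₁ R₂ f
    (thm31SiteSchemasR_of_t37_lawS R₁ R₂ specialUnitaryUnits_le_unitaryUnits hGR b 𝔏 hlev hβ1 hnbr 𝔬 t37 hC hδ0 hconv hblkS hblkYS hGpS hDS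
      haK hlawS)
    (thm32BlkSchema_of_majorants_J R₁ R₂ 𝔏 f hlev hβ1 (R := fun _ => (0 : ℝ)) (H := fun _ => True)
      (majorants348_of_display348_R_at_J θ Mstar 𝔏 R₁ R₂ bI (fun x => parKnitY x.toKIdx) hparS f hc hB hδ ha₁ hM₁ h348))

end Knit

end Literature.MathematicalPhysics.QuantumFieldTheory.Balaban1983to89.B9Ineq349SiteFacesAtLettersRLawsJ

end
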